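import Summits.BirchSwinnertonDyer.Rank1Residual.Additive.GordDescent
import Summits.BirchSwinnertonDyer.BirchSwinnertonDyer.Theorems.ToricSheddingUBPotentiallyGoodStubTwistAdmissible
import Literature.NumberTheory.EllipticCurves.ExceptionalPrimesDensityModels
import HarnessLib

/-!
# Surjectivity of `ρ̄_{E,p}` is invariant under quadratic twist; X4♯(G-ord) at `p = 3` with surj(3) ON `E`

HONEST FRAMING (cell `b2b-bsdres`, run/shared/lean/b2b/bsd-rank1-residual/, verbatim in every
file): the goal of the cell is to DELETE the COMBINATION-SHAPED residual classes of the
Birch–Swinnerton-Dyer formula for ALL analytic-rank `≤ 1` elliptic curves over `ℚ` — "full BSD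
formula for every rank `≤ 1` curve in class `C`" assembled STRICTLY from published theorems — so
that the rank-`≤ 1` remainder becomes exactly the CONSTRUCTION-SHAPED classes, which are TYPED
(missing-input `Prop`s), NOT attempted. This is not "finishing BSD". Sub-cell `additive-p2`
(X3/X4 at an additive prime, potentially good ORDINARY half): research route; no claim beyond the
stated classes; theorems only, no named fact.

Galois-module lemma (folklore; Silverman *AEC* X.5 Cor. 5.4: `E^{(d)}[p] ≅ E[p] ⊗ χ_d`): **for a
prime `p` and `d ∈ ℚ^×`, `ρ̄_{E^{(d)},p}` is surjective iff `ρ̄_{E,p}` is** (`surj_quadraticTwist_iff`,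
`surj_iff_of_model_twist`). The transport itself is ALREADY in the tree (route file
`Theorems/ToricSheddingUBPotentiallyGoodStubTwistAdmissible.lean`:
`twistAdmissible_hasSurjectiveModNGaloisRep_of_addEquiv_signed` — a `±`-equivariant
`f : E₁(ℚ̄) ≃+ E₂(ℚ̄)` transports surjectivity because the two images agree up to the central `−1`,
every square lies in the image, and `−1 = J²` is a square in `Aut(E[p])`); this file only applies it
in BOTH directions along the twisting isomorphism `E^{(d)}(ℚ̄) ≃+ E(ℚ̄)`, `f(σP) = χ_d(σ)·σf(P)`
(`exists_addEquiv_geomPoints_quadraticTwist_signed`) and its inverse, and adds model-independence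
(`hasSurjectiveModNGaloisRep_smul_iff`).

Consumer (row C16 of the cell's partition at `p = 3`, `GordDescent.bsdp_three_of_classX4_of_goodOrd_twist`
asks `Surj Wd 3 ∨ Ram Wd 3` for the TWIST `Wd ≅ E^{(−3)}`): `bsdp_three_of_classX4_of_goodOrd_twist_of_surj`
— the surjectivity hypothesis may be put on `E` itself. (All 151 census pairs of X4♯(G-ord) at
`p = 3` are of type `I₀*`; X4 at `3` with surj(3) is the bulk of them.)

References: J. H. Silverman, *AEC* X.5 Cor. 5.4, X.2 Prop. 2.4, III.6.4(b); J.-P. Serre, Invent.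
Math. 15 (1972) §4; X. Yan, X. Zhu, J. Algebra 693 (2026) Thm. 4.15 (row C16); C. Wuthrich, LMS LNS
414 (2014) Lemma 20.
-/

noncomputable section

open scoped Classical

open WeierstrassCurve Field Literature.NumberTheory.EllipticCurves
  Literature.NumberTheory.EllipticCurves.Rank1Residual
  Literature.NumberTheory.EllipticCurves.Rank1Residual.Typed
  Literature.NumberTheory.EllipticCurves.ModularForms
  Literature.NumberTheory.EllipticCurves.Wuthrich2014
  Summit.BirchSwinnertonDyer.Rank1Residual.AdditivePotMult
  Summit.BirchSwinnertonDyer.BirchSwinnertonDyer.Theorems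

namespace Summit.BirchSwinnertonDyer.Rank1Residual.Additive

/-! ### Surjectivity is invariant under quadratic twist -/

variable (W : WeierstrassCurve ℚ) [W.IsElliptic] (p : ℕ) [hp : Fact p.Prime]

/-- **`Surj E^{(d)} p ↔ Surj E p`** for every prime `p` and `d ∈ ℚ^×`: the twisting isomorphism
`f : E^{(d)}(ℚ̄) ≃+ E(ℚ̄)` is `χ_d`-equivariant (`exists_addEquiv_geomPoints_quadraticTwist_signed`;
Silverman *AEC* X.5 Cor. 5.4), so is `f⁻¹`, and the tree's
`twistAdmissible_hasSurjectiveModNGaloisRep_of_addEquiv_signed` applies in both directions. -/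
theorem surj_quadraticTwist_iff {d : ℚ} (hd : d ≠ 0) :
    haveI := W.isElliptic_quadraticTwist hd
    Surj (W.quadraticTwist d) p ↔ Surj W p := by
  haveI := W.isElliptic_quadraticTwist hd
  haveI : NeZero (2 : ℚ) := ⟨two_ne_zero⟩
  obtain ⟨f, hf⟩ := W.exists_addEquiv_geomPoints_quadraticTwist_signed hd
  have hf' : ∀ σ : absoluteGaloisGroup ℚ,
      (∀ Q, f.symm (σ • Q) = σ • f.symm Q) ∨ (∀ Q, f.symm (σ • Q) = -(σ • f.symm Q)) := by
    intro σ
    rcases hf σ with h | h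
    · left
      intro Q
      apply f.injective
      rw [AddEquiv.apply_symm_apply, h, AddEquiv.apply_symm_apply]
    · right
      intro Q
      apply f.injective
      rw [AddEquiv.apply_symm_apply, map_neg, h, AddEquiv.apply_symm_apply, neg_neg]
  exact ⟨fun h ↦ twistAdmissible_hasSurjectiveModNGaloisRep_of_addEquiv_signed f.symm hf' p h,
    fun h ↦ twistAdmissible_hasSurjectiveModNGaloisRep_of_addEquiv_signed f hf p h⟩

/-- **Surjectivity for any `ℚ`-model of the twist**: if `C • E^{(d)} = Wd` over `ℚ` (e.g. `Wd` a
globally minimal model of `E^{(d)}`) then `Surj Wd p ↔ Surj E p` (model-independence: tree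
`hasSurjectiveModNGaloisRep_smul_iff`). -/
theorem surj_iff_of_model_twist {d : ℚ} (hd : d ≠ 0) {Wd : WeierstrassCurve ℚ}
    (hWd : ∃ C : VariableChange ℚ, C • W.quadraticTwist d = Wd) : Surj Wd p ↔ Surj W p := by
  obtain ⟨C, rfl⟩ := hWd
  unfold Surj
  rw [hasSurjectiveModNGaloisRep_smul_iff]
  exact surj_quadraticTwist_iff W p hd

/-! ### Consumer: X4♯(G-ord) at `p = 3` with surj(3) placed on `E` -/

variable [W.IsGloballyMinimal] (K : Type) [Field K] [NumberField K]
  (Wd : WeierstrassCurve ℚ) [Wd.IsElliptic] [Wd.IsGloballyMinimal]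

/-- **X4♯(G-ord) at `p = 3`, surj(3) for `E` itself.** As
`GordDescent.bsdp_three_of_classX4_of_goodOrd_twist` (row C16 for the twist pair: Yan–Zhu 2026
Thm. 4.15 `hYZ`, Wuthrich 2014 Lemma 20 `hW20`, Milne `hMilne`, GZK, modularity), with the row's
image hypothesis `Surj Wd 3` DISCHARGED from `Surj W 3` by `surj_iff_of_model_twist`: for
`(E, 3) ∈ X4` with `ρ̄_{E,3}` onto, `r_an(E) ≤ 1`, `K = ℚ(√−3)`, `Wd` a globally minimal model of
`E^{(−3)}` GOOD ORDINARY at `3` of analytic rank `≤ 1`, and `W'` a globally minimal `K`-model of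
`E_K`: `BSD(E,3)` follows from `MissingPPartOverAt W' 3` ALONE.
[cite: YanZhu2024MainConjNonCM, Thm. 4.15 (§4.6)] [cite: Wuthrich2014, Lemma 20 (p. 399)] -/
theorem bsdp_three_of_classX4_of_goodOrd_twist_of_surj [Fact (3 : ℕ).Prime]
    (W'₃ : WeierstrassCurve K) [W'₃.IsElliptic] [W'₃.IsGloballyMinimal]
    (hGZK : rank_eq_analyticRank_of_analyticRank_le_one) (hmod : hasEntireLFunction_rat)
    (hMilne : Milne1972.bsdQuotient_baseChange_quadratic)
    (hYZ : YanZhu2026.thm415_padicValRat_bsd_rank_le_one)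
    (hW20 : Wuthrich2014.lemma20_surjective_threeAdic_of_semistable)
    (hX : ClassX4 W 3) (hsurj : Surj W 3) (hr : W.analyticRank ≤ 1)
    (h2 : Module.finrank ℚ K = 2) (hdK : (NumberField.discr K : ℚ) = -3)
    (hWd : ∃ C : VariableChange ℚ, C • W.quadraticTwist (NumberField.discr K : ℚ) = Wd)
    (hord : GoodOrd Wd 3) (hrd : Wd.analyticRank ≤ 1)
    (hW' : ∃ C : VariableChange K, C • W.baseChange K = W'₃) (hK : MissingPPartOverAt W'₃ 3) :
    BSDp W 3 := by
  have hd3 : (NumberField.discr K : ℚ) ≠ 0 := by rw [hdK]; norm_num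
  have hsurjd : Surj Wd 3 := (surj_iff_of_model_twist W 3 hd3 hWd).mpr hsurj
  exact bsdp_three_of_classX4_of_goodOrd_twist W K Wd W'₃ hGZK hmod hMilne hYZ hW20 hX hr h2 hdK
    hWd hord (Or.inl hsurjd) hrd hW' hK

end Summit.BirchSwinnertonDyer.Rank1Residual.Additive

end
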